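import Mathlib.Analysis.Complex.Basic
import Mathlib.Data.Nat.Factorial.Basic
import Mathlib.Algebra.Module.Pi
import HarnessLib

/-!
# The `𝔰𝔩₂`-triple of `Sym^d` in weight coordinates, with values in a module

For a complex module `α` and `d : ℕ`, an `α`-valued coordinate vector `u : ℕ → α` supported on
`{0, …, d}` (think `∑_l u_l ⊗ x^l y^{d−l} ∈ α ⊗ Sym^d(ℂ²)`; the support condition is the submodule
`supp α d`) is acted on by

  `(E u)_l = (d + 1 − l) u_{l−1}` (`0` at `l = 0`),  `(F u)_l = (l + 1) u_{l+1}`,  `(H u)_l = (2l − d) u_l`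

— `E = x ∂_y`, `F = y ∂_x`, `H = x ∂_x − y ∂_y` on binary forms of degree `d` read in coordinates
[cite: FultonHarrisGTM129, §11.1 (11.6)–(11.8)].  Proved here: stability of the support
(`sE_mem`, `sF_mem`, `sH_mem`), the `𝔰𝔩₂` relations on supported vectors (`sH_sE`, `sH_sF`,
`sE_sF`), the Casimir identity `½H² + EF + FE = ½ d(d+2)` (`casimir_apply`), naturality in `α`
(`sE_comp`, `sF_comp`, `sH_comp`), the invariant Hermitian structure for the weights
`g_l = l! (d−l)!` — `∑_l g_l ⟪(E u)_l, v_l⟫ = ∑_l g_l ⟪u_l, (F v)_l⟫` (`sum_sE_eq_sum_sF`, i.e. `E† = F`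
for the admissible inner product `⟨x^a y^b, x^a y^b⟩ = a! b!` [cite: FultonHarrisGTM129, §11.1])
— and the extreme weight vectors (`sE_single_top`, `sF_single_zero`, `sH_single`).

No named fact; definitions `sE, sF, sH, supp, wt`.
-/

noncomputable section

open Finset Complex
open scoped BigOperators ComplexConjugate

namespace Literature.NumberTheory.Automorphic

namespace Sl2Coord

variable {α : Type*} [AddCommGroup α] [Module ℂ α] (d : ℕ)

/-! ### The three operators on `ℕ → α` -/

/-- `(E u)_l = (d + 1 − l) u_{l−1}`, `(E u)_0 = 0`. [cite: FultonHarrisGTM129, §11.1] -/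
def sE : Module.End ℂ (ℕ → α) where
  toFun u l := if l = 0 then 0 else ((d + 1 - l : ℕ) : ℂ) • u (l - 1)
  map_add' u v := by funext l; by_cases h : l = 0 <;> simp [h, smul_add]
  map_smul' c u := by funext l; by_cases h : l = 0 <;> simp [h, smul_comm c]

/-- `(F u)_l = (l + 1) u_{l+1}`. [cite: FultonHarrisGTM129, §11.1] -/
def sF : Module.End ℂ (ℕ → α) where
  toFun u l := ((l + 1 : ℕ) : ℂ) • u (l + 1)
  map_add' u v := by funext l; simp [smul_add]
  map_smul' c u := by funext l; simp [smul_comm c]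

/-- `(H u)_l = (2l − d) u_l`. [cite: FultonHarrisGTM129, §11.1] -/
def sH : Module.End ℂ (ℕ → α) where
  toFun u l := ((2 * l : ℕ) - d : ℂ) • u l
  map_add' u v := by funext l; simp [smul_add]
  map_smul' c u := by funext l; simp [smul_comm c]

variable {d}

/-- Unfolding `E`. [folklore] -/
theorem sE_apply (u : ℕ → α) (l : ℕ) :
    sE d u l = if l = 0 then 0 else ((d + 1 - l : ℕ) : ℂ) • u (l - 1) := rfl
/-- `E` at `0`. [folklore] -/
@[simp] theorem sE_apply_zero (u : ℕ → α) : sE d u 0 = (0 : α) := by simp [sE_apply]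
/-- `E` at a successor. [folklore] -/
@[simp] theorem sE_apply_succ (u : ℕ → α) (l : ℕ) :
    sE d u (l + 1) = ((d - l : ℕ) : ℂ) • u l := by
  simp [sE_apply]
/-- Unfolding `F`. [folklore] -/
@[simp] theorem sF_apply (u : ℕ → α) (l : ℕ) : sF (α := α) u l = ((l + 1 : ℕ) : ℂ) • u (l + 1) := rfl
/-- Unfolding `H`. [folklore] -/
@[simp] theorem sH_apply (u : ℕ → α) (l : ℕ) : sH d u l = ((2 * l : ℕ) - d : ℂ) • u l := rfl

/-! ### Supports -/

variable (α d) in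
/-- The coordinate vectors supported on `{0, …, d}` (the copy of `α ⊗ Sym^d`). [folklore] -/
def supp : Submodule ℂ (ℕ → α) where
  carrier := {u | ∀ l, d < l → u l = 0}
  zero_mem' := fun _ _ => rfl
  add_mem' hu hv l hl := by simp [hu l hl, hv l hl]
  smul_mem' c u hu l hl := by simp [hu l hl]

/-- Membership in `supp`. [folklore] -/
theorem mem_supp {u : ℕ → α} : u ∈ supp α d ↔ ∀ l, d < l → u l = 0 := Iff.rfl

/-- `E` preserves the support. [folklore] -/
theorem sE_mem {u : ℕ → α} (hu : u ∈ supp α d) : sE d u ∈ supp α d := by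
  intro l hl
  rcases l with _ | l
  · simp
  · rw [sE_apply_succ]
    rcases Nat.lt_or_ge d (l + 0) with h | h
    · rw [hu l (by omega), smul_zero]
    · have : d - l = 0 := by omega
      rw [this, Nat.cast_zero, zero_smul]

/-- `F` preserves the support. [folklore] -/
theorem sF_mem {u : ℕ → α} (hu : u ∈ supp α d) : sF u ∈ supp α d := fun l hl => by
  rw [sF_apply, hu (l + 1) (by omega), smul_zero]

/-- `H` preserves the support. [folklore] -/
theorem sH_mem {u : ℕ → α} (hu : u ∈ supp α d) : sH d u ∈ supp α d := fun l hl => by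
  rw [sH_apply, hu l hl, smul_zero]

/-! ### The `𝔰𝔩₂` relations -/

/-- `[H, E] = 2E` (on all of `ℕ → α`). [cite: FultonHarrisGTM129, §11.1] -/
theorem sH_sE (u : ℕ → α) : sH d (sE d u) = sE d (sH d u) + (2 : ℂ) • sE d u := by
  funext l
  rcases l with _ | l
  · simp
  · simp only [sH_apply, sE_apply_succ, Pi.add_apply, Pi.smul_apply, smul_smul, ← add_smul]
    congr 1
    push_cast
    ring

/-- `[H, F] = −2F` (on all of `ℕ → α`). [cite: FultonHarrisGTM129, §11.1] -/
theorem sH_sF (u : ℕ → α) : sH d (sF u) = sF (sH d u) - (2 : ℂ) • sF u := by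
  funext l
  simp only [sH_apply, sF_apply, Pi.sub_apply, Pi.smul_apply, smul_smul, ← sub_smul]
  congr 1
  push_cast
  ring

/-- `[E, F] = H` on vectors supported on `{0, …, d}`. [cite: FultonHarrisGTM129, §11.1] -/
theorem sE_sF {u : ℕ → α} (hu : u ∈ supp α d) : sE d (sF u) = sF (sE d u) + sH d u := by
  funext l
  rcases l with _ | l
  · simp only [sE_apply_zero, Pi.add_apply, sF_apply, sE_apply_succ, sH_apply, smul_smul,
      ← add_smul, zero_add, Nat.sub_zero, mul_zero, Nat.cast_zero, zero_sub]
    rw [eq_comm]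
    convert zero_smul ℂ (u 0) using 2
    push_cast; ring
  · simp only [Pi.add_apply, sF_apply, sE_apply_succ, sH_apply, smul_smul]
    rcases Nat.lt_or_ge d (l + 1) with h | h
    · -- beyond the support everything vanishes
      simp [hu (l + 1) h]
    · rw [← add_smul]
      congr 1
      have e1 : ((d - l : ℕ) : ℂ) = (d : ℂ) - l := by rw [Nat.cast_sub (by omega)]
      have e2 : ((d - (l + 1) : ℕ) : ℂ) = (d : ℂ) - (l + 1) := by
        rw [Nat.cast_sub h]; push_cast; ring
      rw [e2]
      push_cast
      rw [e1]
      ring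

/-- `(F E u)_l = (l + 1)(d − l) u_l` inside the support. [folklore] -/
theorem sF_sE_apply (u : ℕ → α) (l : ℕ) :
    sF (sE d u) l = ((l + 1 : ℕ) * (d - l : ℕ) : ℂ) • u l := by
  rw [sF_apply, sE_apply_succ, smul_smul]

/-- **The Casimir of `Sym^d`**: `½ H² + EF + FE = ½ d(d + 2)` on supported vectors.
[cite: FultonHarrisGTM129, §11.1] -/
theorem casimir_apply {u : ℕ → α} (hu : u ∈ supp α d) :
    (2 : ℂ)⁻¹ • sH d (sH d u) + sE d (sF u) + sF (sE d u) = ((2 : ℂ)⁻¹ * (d * (d + 2))) • u := by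
  rw [sE_sF hu]
  funext l
  simp only [Pi.add_apply, Pi.smul_apply, sH_apply, sF_sE_apply, smul_smul, ← add_smul]
  rcases Nat.lt_or_ge d l with h | h
  · rw [hu l h, smul_zero, smul_zero]
  · congr 1
    have e1 : ((d - l : ℕ) : ℂ) = (d : ℂ) - l := by rw [Nat.cast_sub h]
    push_cast
    rw [e1]
    ring

/-! ### Naturality in `α` -/

variable {β : Type*} [AddCommGroup β] [Module ℂ β] (T : α →ₗ[ℂ] β)

/-- `E` commutes with coordinatewise linear maps. [folklore] -/
theorem sE_comp (u : ℕ → α) : sE d (fun l => T (u l)) = fun l => T (sE d u l) := by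
  funext l; rcases l with _ | l <;> simp

/-- `F` commutes with coordinatewise linear maps. [folklore] -/
theorem sF_comp (u : ℕ → α) : sF (fun l => T (u l)) = fun l => T (sF u l) := by
  funext l; simp

/-- `H` commutes with coordinatewise linear maps. [folklore] -/
theorem sH_comp (u : ℕ → α) : sH d (fun l => T (u l)) = fun l => T (sH d u l) := by
  funext l; simp

/-! ### The admissible Hermitian structure: `E† = F`, `H† = H` -/

/-- The weights `g_l = l! (d − l)!` of the admissible inner product `⟨x^l y^{d−l}, x^l y^{d−l}⟩ = l!(d−l)!`
on `Sym^d`. [cite: FultonHarrisGTM129, §11.1] -/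
def wt (d l : ℕ) : ℂ := ((l.factorial * (d - l).factorial : ℕ) : ℂ)

/-- The weights are positive reals. [folklore] -/
theorem wt_eq (l : ℕ) : wt d l = ((l.factorial * (d - l).factorial : ℕ) : ℝ) := by
  simp [wt]

/-- The balance `(d − l) g_{l+1} = (l + 1) g_l` (`l < d`) behind `E† = F`. [folklore] -/
theorem wt_succ_mul {l : ℕ} (hl : l < d) :
    ((d - l : ℕ) : ℂ) * wt d (l + 1) = ((l + 1 : ℕ) : ℂ) * wt d l := by
  simp only [wt]
  norm_cast
  have h1 : d - l = (d - (l + 1)) + 1 := by omega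
  rw [Nat.factorial_succ, h1, Nat.factorial_succ]
  ring

/-- **`E† = F` for the admissible form**: for any form `ip` on `α` which is additive and
conjugate-homogeneous in the first and homogeneous in the second variable,
`∑_{l ≤ d} g_l ip (E u)_l v_l = ∑_{l ≤ d} g_l ip u_l (F v)_l` for `v` supported on `{0,…,d}`.
[cite: FultonHarrisGTM129, §11.1] [cite: BorelWallach2000, II §2.2] -/
theorem sum_sE_eq_sum_sF {ip : α → α → ℂ}
    (hl : ∀ (c : ℂ) x y, ip (c • x) y = conj c * ip x y) (hr : ∀ (c : ℂ) x y, ip x (c • y) = c * ip x y)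
    (h0 : ∀ y, ip 0 y = 0) (h0' : ∀ x, ip x 0 = 0) (u : ℕ → α) {v : ℕ → α}
    (hv : v ∈ supp α d) :
    ∑ l ∈ range (d + 1), wt d l * ip (sE d u l) (v l) =
      ∑ l ∈ range (d + 1), wt d l * ip (u l) (sF v l) := by
  -- left: reindex `l = m + 1`
  rw [Finset.sum_range_succ', sE_apply_zero, h0, mul_zero, add_zero]
  rw [Finset.sum_range_succ, sF_apply, hv (d + 1) (by omega), smul_zero, h0', mul_zero, add_zero]
  refine Finset.sum_congr rfl fun m hm => ?_
  rw [Finset.mem_range] at hm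
  rw [sE_apply_succ, sF_apply, hl, hr, Complex.conj_natCast, ← mul_assoc, ← mul_assoc,
    mul_comm (wt d (m + 1)), wt_succ_mul hm, mul_comm (wt d m)]

/-- **`H` is diagonal with real eigenvalues**: `∑ g_l ip (H u)_l v_l = ∑ g_l ip u_l (H v)_l`. [folklore] -/
theorem sum_sH_eq {ip : α → α → ℂ}
    (hl : ∀ (c : ℂ) x y, ip (c • x) y = conj c * ip x y) (hr : ∀ (c : ℂ) x y, ip x (c • y) = c * ip x y)
    (u v : ℕ → α) :
    ∑ l ∈ range (d + 1), wt d l * ip (sH d u l) (v l) =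
      ∑ l ∈ range (d + 1), wt d l * ip (u l) (sH d v l) := by
  refine Finset.sum_congr rfl fun l _ => ?_
  rw [sH_apply, sH_apply, hl, hr, map_sub, Complex.conj_natCast, Complex.conj_natCast]

/-! ### Extreme weight vectors -/

/-- `Pi.single d a` (the top monomial `a ⊗ x^d`) is supported on `{0,…,d}`. [folklore] -/
theorem single_mem (l : ℕ) (hl : l ≤ d) (a : α) : (Pi.single l a : ℕ → α) ∈ supp α d :=
  fun m hm => by rw [Pi.single_eq_of_ne (by omega)]

/-- `E (a ⊗ x^d) = 0`. [folklore] -/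
theorem sE_single_top (a : α) : sE d (Pi.single d a) = 0 := by
  funext l
  rcases l with _ | l
  · simp
  · rw [sE_apply_succ, Pi.zero_apply]
    by_cases h : l = d
    · subst h; simp
    · rcases Nat.lt_or_ge l d with h' | h'
      · rw [Pi.single_eq_of_ne (by omega), smul_zero]
      · have : d - l = 0 := by omega
        rw [this, Nat.cast_zero, zero_smul]

/-- `F (a ⊗ y^d) = 0`. [folklore] -/
theorem sF_single_zero (a : α) : sF (α := α) (Pi.single 0 a) = 0 := by
  funext l; simp

/-- `H (a ⊗ x^l y^{d−l}) = (2l − d) (a ⊗ x^l y^{d−l})`. [folklore] -/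
theorem sH_single (l : ℕ) (a : α) : sH d (Pi.single l a) = (((2 * l : ℕ) : ℂ) - d) • Pi.single l a := by
  funext m
  rw [sH_apply, Pi.smul_apply]
  by_cases h : m = l
  · subst h; rfl
  · rw [Pi.single_eq_of_ne h, smul_zero, smul_zero]

/-- `F (a ⊗ x^{l+1} y^{d−l−1}) = (l + 1) (a ⊗ x^l y^{d−l})`. [folklore] -/
theorem sF_single_succ (l : ℕ) (a : α) :
    sF (α := α) (Pi.single (l + 1) a) = ((l + 1 : ℕ) : ℂ) • Pi.single l a := by
  funext m
  rw [sF_apply, Pi.smul_apply]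
  by_cases h : m = l
  · subst h; simp
  · rw [Pi.single_eq_of_ne (by omega), Pi.single_eq_of_ne h, smul_zero, smul_zero]

/-- `E (a ⊗ x^{l} y^{d−l}) = (d − l) (a ⊗ x^{l+1} y^{d−l−1})`. [folklore] -/
theorem sE_single (l : ℕ) (a : α) :
    sE d (Pi.single l a) = ((d - l : ℕ) : ℂ) • Pi.single (l + 1) a := by
  funext m
  rcases m with _ | m
  · simp
  · rw [sE_apply_succ, Pi.smul_apply]
    by_cases h : m = l
    · subst h; simp
    · rw [Pi.single_eq_of_ne h, Pi.single_eq_of_ne (by omega), smul_zero, smul_zero]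

/-- **`F^j (a ⊗ x^d) = d!/(d−j)! (a ⊗ x^{d−j} y^{j})`** (`j ≤ d`): the lowering string of the
highest-weight vector is non-zero down to the bottom. [cite: FultonHarrisGTM129, §11.1] -/
theorem sF_pow_single_top {j : ℕ} (hj : j ≤ d) (a : α) :
    (sF (α := α) ^ j) (Pi.single d a) = ((d.factorial / (d - j).factorial : ℕ) : ℂ) • Pi.single (d - j) a := by
  induction j with
  | zero => simp [Nat.div_self (Nat.factorial_pos d)]
  | succ j ih =>
    rw [pow_succ', Module.End.mul_apply, ih (by omega), map_smul]
    have e : d - j = (d - (j + 1)) + 1 := by omega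
    rw [e, sF_single_succ, smul_smul, ← e]
    congr 1
    -- `d!/(d−j)! · (d − j) = d!/(d−j−1)!`
    have hdvd' : (d - j).factorial ∣ d.factorial := Nat.factorial_dvd_factorial (by omega)
    rw [← Nat.cast_mul]
    congr 1
    have hf : (d - j).factorial = (d - j) * (d - (j + 1)).factorial := by
      conv_lhs => rw [e, Nat.factorial_succ, ← e]
    refine (Nat.div_eq_of_eq_mul_left (Nat.factorial_pos _) ?_).symm
    rw [mul_assoc, ← hf, Nat.div_mul_cancel hdvd']

end Sl2Coord

end Literature.NumberTheory.Automorphic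

end
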